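import Literature.AlgebraicGeometry.HodgeTheory.QuaternionicQuarticDeckChartInCoverFibre
import Literature.AlgebraicGeometry.HodgeTheory.QuaternionicQuarticCoverFibres
import Mathlib.AlgebraicGeometry.Birational.Birational
import HarnessLib

/-!
# The deck chart of a good fibre is DENSE: `Spec (DeckRing X_φ)` and `𝒱_φ` are birational over `L` (M1-1, clause (iii) form)

Layer `Literature/AlgebraicGeometry/HodgeTheory`. Theorems only; no named fact. Written by the prover seat
`hodge-nonav-19716-p2` (g13, cell `hodge-nonav`) for prover-Bx's `Q8FamilyDeck_birational` / stub S7 of crux K1Q (route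
`HodgeConjecture/Q8SymplecticPowers`, stmt-HodgeConjecture-24190), completing the fibrewise form of brick M1-1
(`QuaternionicQuarticDeckChartInCoverFibre`):

* `deckRingBaseChangeEquiv_one_tmul`, `deckRingBaseChangeEquiv_comp_includeRight` — prover-Bx's base-change isomorphism
  `DeckRing X ⊗_R S ≅ DeckRing X_S` is `S`-linear on `1 ⊗ S`; hence **`deckChartTensorLeftIso_inv_comp_snd`**: the scheme
  isomorphism `(deckChart X ⊗ Spec S).left ≅ Spec (DeckRing X_S)` lies OVER `Spec S`;
* **`exists_chartEmb_fibre_over`** — the open immersion `Spec (DeckRing X_L) ⟶ (fiberSch e (algebraMap A L)).left` of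
  `exists_chartEmb_fibre`, now recorded as a morphism OVER `Spec L`, image `fiberEmb⁻¹ D₊(x₂·H̃_L)`;
* **`exists_chartEmb_fibre_dominant`**, **`birationalOver_deckChart_fiberSch`** — over a FIELD point with `φ(G_e) ≠ 0`
  (irreducible fibre, brick C3) and non-empty deck chart (`Nontrivial (DeckRing X_L)`), the chart is a dense open of the fibre,
  so `Spec (DeckRing X_L)` and `𝒱_φ` are `Scheme.BirationalOver` `Spec L` (Mathlib `Scheme.Hom.birationalOver`);
* **`birationalOver_deckChart_of_isHypersurfaceCutOutBy`** (appended) — at a complex point `φ` with `φ(G_e) ≠ 0` and non-empty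
  chart, `Spec (DeckRing X_φ)` is birational over `ℂ` to EVERY `V` with `IsHypersurfaceCutOutBy 3 (quarticForm e (c_φ, ψ_φ)) V`
  (∘ brick C3 `nonempty_iso_of_isHypersurfaceCutOutBy_quarticForm`) — the «common open» half of `Q8FamilyDeck` clause (iii).

Honest scope: base-change bookkeeping + «a non-empty open of an irreducible space is dense»; nothing here bears on HC.

## References

* [AtiyahMacdonald1969] M. F. Atiyah, I. G. Macdonald, Introduction to Commutative Algebra (1969), Thm. 1.3.
* [GortzWedhorn2020] U. Görtz, T. Wedhorn, Algebraic Geometry I, 2nd ed. (2020), Prop. 4.18, Prop. 4.32 (2).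
* [Hartshorne1977] R. Hartshorne, Algebraic Geometry (1977), I Example 1.1.3.
* [Liu2002] Q. Liu, Algebraic Geometry and Arithmetic Curves (2002), Rem. 3.1.20.
-/

noncomputable section

set_option backward.isDefEq.respectTransparency false

open CategoryTheory CategoryTheory.Limits AlgebraicGeometry MvPolynomial HomogeneousLocalization TopologicalSpace MonoidalCategory
  CartesianMonoidalCategory TensorProduct
open Literature.AlgebraicGeometry.Motives Literature.AlgebraicGeometry.Motives.UniversalHypersurface

namespace Literature.AlgebraicGeometry.HodgeTheory.Q8Family

attribute [local instance] MvPolynomial.gradedAlgebra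

section BaseChangeOver

universe v

variable {R : Type v} [CommRing R] (S : Type v) [CommRing S] [Algebra R S] {e : ℕ} (a : CIdx e → R)

/-- The base-change isomorphism on `1 ⊗ s`: the scalar `s`. [cite: GortzWedhorn2020, Prop. 4.18] -/
theorem deckRingBaseChangeEquiv_one_tmul (s : S) :
    deckRingBaseChangeEquiv S a ((1 : DeckRing a) ⊗ₜ[R] s) = algebraMap S (DeckRing (algebraMap R S ∘ a)) s := by
  have h1 : (1 : DeckRing a) = Ideal.Quotient.mk (deckIdeal a) 1 := (map_one _).symm
  rw [h1, deckRingBaseChangeEquiv, AlgEquiv.trans_apply, Resolution.polyQuotientBaseChangeEquiv_tmul, map_one, map_one,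
    one_mul]
  rfl

/-- The base-change isomorphism restricted to `S = 1 ⊗ S` is the structure map of the `S`-algebra `DeckRing X_S`.
[cite: GortzWedhorn2020, Prop. 4.18] -/
theorem deckRingBaseChangeEquiv_comp_includeRight :
    (deckRingBaseChangeEquiv S a : TensorProduct R (DeckRing a) S →+* DeckRing (algebraMap R S ∘ a)).comp
        (Algebra.TensorProduct.includeRight (R := R) (A := DeckRing a) (B := S)).toRingHom =
      algebraMap S (DeckRing (algebraMap R S ∘ a)) := by
  refine RingHom.ext fun s => ?_
  exact deckRingBaseChangeEquiv_one_tmul S a s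

/-- **`(deckChart X ⊗ Spec S).left ≅ Spec (DeckRing X_S)` lies over `Spec S`**: the inverse followed by the projection to
`Spec S` is `Spec` of the structure map. [cite: GortzWedhorn2020, Prop. 4.18] -/
theorem deckChartTensorLeftIso_inv_comp_snd :
    (deckChartTensorLeftIso S a).inv ≫ (CartesianMonoidalCategory.snd (deckChart a) (specOver R S)).left =
      Spec.map (CommRingCat.ofHom (algebraMap S (DeckRing (algebraMap R S ∘ a)))) := by
  have h1 : (pullbackSpecIso R (DeckRing a) S).inv ≫ (CartesianMonoidalCategory.snd (deckChart a) (specOver R S)).left =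
      Spec.map (CommRingCat.ofHom (Algebra.TensorProduct.includeRight (R := R) (A := DeckRing a) (B := S)).toRingHom) :=
    pullbackSpecIso_inv_snd R (DeckRing a) S
  change Spec.map (CommRingCat.ofHom
      (deckRingBaseChangeEquiv S a : TensorProduct R (DeckRing a) S →+* DeckRing (algebraMap R S ∘ a))) ≫
    (pullbackSpecIso R (DeckRing a) S).inv ≫ (CartesianMonoidalCategory.snd (deckChart a) (specOver R S)).left = _
  rw [h1, ← Spec.map_comp, ← CommRingCat.ofHom_comp, deckRingBaseChangeEquiv_comp_includeRight]

/-- The same for the forward isomorphism. [cite: GortzWedhorn2020, Prop. 4.18] -/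
theorem deckChartTensorLeftIso_hom_comp_specMap :
    (deckChartTensorLeftIso S a).hom ≫ Spec.map (CommRingCat.ofHom (algebraMap S (DeckRing (algebraMap R S ∘ a)))) =
      (CartesianMonoidalCategory.snd (deckChart a) (specOver R S)).left := by
  rw [← deckChartTensorLeftIso_inv_comp_snd S a, Iso.hom_inv_id_assoc]

end BaseChangeOver

section Birational

variable (e : ℕ)

/-- **M1-1, FIBREWISE, over `Spec L`.** For every `A`-algebra `L` the open immersion `Spec (DeckRing X_L) ⟶ 𝒱 ×_A Spec L` of
`exists_chartEmb_fibre` is a morphism OVER `Spec L`, with image `fiberEmb⁻¹ D₊(x₂·H̃_L)` (open immersions are stable under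
base change). [cite: GortzWedhorn2020, Prop. 4.32 (2)] [cite: Liu2002, Rem. 3.1.20] -/
theorem exists_chartEmb_fibre_over {L : Type} [CommRing L] [Algebra (ParamRing e) L] (he : 1 ≤ e) :
    ∃ (g : Spec (.of (DeckRing (algebraMap (ParamRing e) L ∘ univCoeffs e))) ⟶ (fiberSch e (algebraMap (ParamRing e) L)).left)
      (_ : IsOpenImmersion g),
      g ≫ (fiberSch e (algebraMap (ParamRing e) L)).hom =
        Spec.map (CommRingCat.ofHom (algebraMap L (DeckRing (algebraMap (ParamRing e) L ∘ univCoeffs e)))) ∧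
      Set.range g = fiberEmb e (algebraMap (ParamRing e) L) ⁻¹'
        (Proj.basicOpen (homogeneousSubmodule (Fin (2 + 2)) L)
          (X 2 * branchForm (fun i => algebraMap (ParamRing e) L (X i))) : Set _) := by
  obtain ⟨g, hg, hover, hran⟩ := exists_chartEmb_baseChange e (L := L) he
  refine ⟨(deckChartTensorLeftIso L (univCoeffs e)).inv ≫ g, inferInstance, ?_, ?_⟩
  · rw [Category.assoc, hover]
    exact deckChartTensorLeftIso_inv_comp_snd L (univCoeffs e)
  · have hsurj : Function.Surjective (deckChartTensorLeftIso L (univCoeffs e)).inv :=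
      (deckChartTensorLeftIso L (univCoeffs e)).inv.homeomorph.surjective
    rw [← hran]
    ext y
    simp only [Set.mem_range]
    constructor
    · rintro ⟨x, rfl⟩
      exact ⟨_, rfl⟩
    · rintro ⟨x, rfl⟩
      obtain ⟨x', rfl⟩ := hsurj x
      exact ⟨x', rfl⟩

variable {L : Type} [Field L] [Algebra (ParamRing e) L]

/-- `Spec` of a non-zero ring is non-empty (it has a maximal ideal). [cite: AtiyahMacdonald1969, Thm. 1.3] -/
theorem nonempty_spec_deckRing [Nontrivial (DeckRing (algebraMap (ParamRing e) L ∘ univCoeffs e))] :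
    Nonempty ↥(Spec (.of (DeckRing (algebraMap (ParamRing e) L ∘ univCoeffs e)))) :=
  inferInstanceAs (Nonempty (PrimeSpectrum (DeckRing (algebraMap (ParamRing e) L ∘ univCoeffs e))))

/-- **The deck chart of a good fibre is a DENSE open.** Over a field-valued point `φ = algebraMap A L` with `φ(G_e) ≠ 0` (so
`𝒱_φ` is irreducible, brick C3) and non-empty deck chart, the open immersion `Spec (DeckRing X_L) ⟶ 𝒱_φ` over `Spec L` is
dominant (a non-empty open subset of an irreducible space is dense). [cite: Hartshorne1977, I Example 1.1.3] -/
theorem exists_chartEmb_fibre_dominant (he : 1 ≤ e) (hG : algebraMap (ParamRing e) L (genericityElem e) ≠ 0)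
    [Nontrivial (DeckRing (algebraMap (ParamRing e) L ∘ univCoeffs e))] :
    ∃ g : Spec (.of (DeckRing (algebraMap (ParamRing e) L ∘ univCoeffs e))) ⟶ (fiberSch e (algebraMap (ParamRing e) L)).left,
      IsOpenImmersion g ∧ IsDominant g ∧
      g ≫ (fiberSch e (algebraMap (ParamRing e) L)).hom =
        Spec.map (CommRingCat.ofHom (algebraMap L (DeckRing (algebraMap (ParamRing e) L ∘ univCoeffs e)))) ∧
      Set.range g = fiberEmb e (algebraMap (ParamRing e) L) ⁻¹'
        (Proj.basicOpen (homogeneousSubmodule (Fin (2 + 2)) L)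
          (X 2 * branchForm (fun i => algebraMap (ParamRing e) L (X i))) : Set _) := by
  obtain ⟨g, hg, hover, hran⟩ := exists_chartEmb_fibre_over e (L := L) he
  haveI : IrreducibleSpace ↥(fiberSch e (algebraMap (ParamRing e) L)).left :=
    irreducibleSpace_fiber_of_genericity e (algebraMap (ParamRing e) L) he hG
  haveI := nonempty_spec_deckRing e (L := L)
  have hd : DenseRange g := (g.isOpenEmbedding.isOpen_range.dense (Set.range_nonempty _))
  exact ⟨g, hg, ⟨hd⟩, hover, hran⟩

/-- **`Spec (DeckRing X_L)` and the fibre `𝒱_φ` are birational over `Spec L`** (`φ = algebraMap A L` a field-valued point with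
`φ(G_e) ≠ 0` and non-empty deck chart): Mathlib's `Scheme.BirationalOver` from the dominant open immersion.
[cite: Hartshorne1977, I Example 1.1.3] [cite: GortzWedhorn2020, Prop. 4.32 (2)] -/
theorem birationalOver_deckChart_fiberSch (he : 1 ≤ e) (hG : algebraMap (ParamRing e) L (genericityElem e) ≠ 0)
    [Nontrivial (DeckRing (algebraMap (ParamRing e) L ∘ univCoeffs e))] :
    Scheme.BirationalOver
      (Spec.map (CommRingCat.ofHom (algebraMap L (DeckRing (algebraMap (ParamRing e) L ∘ univCoeffs e)))))
      (fiberSch e (algebraMap (ParamRing e) L)).hom := by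
  obtain ⟨g, hg, hd, hover, -⟩ := exists_chartEmb_fibre_dominant e (L := L) he hG
  exact Scheme.Hom.birationalOver g _ _ hover

end Birational

section ComplexPoints

variable (e : ℕ)

/-- An isomorphism of `S`-schemes makes them birational over `S`. [cite: GortzWedhorn2020, Prop. 4.32 (2)] -/
theorem birationalOver_of_iso {S : Scheme} {X Y : Over S} (i : X ≅ Y) : Scheme.BirationalOver X.hom Y.hom :=
  Scheme.Hom.birationalOver i.hom.left Y.hom X.hom (Over.w i.hom)

/-- **The deck chart of a good complex member is birational to EVERY hypersurface cut out by its quartic form** (clause (iii)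
shape): for a complex point `φ : A → ℂ` with `φ(G_e) ≠ 0` and non-empty deck chart, and any `V` with
`IsHypersurfaceCutOutBy 3 (quarticForm e (c_φ, ψ_φ)) V`, `Spec (DeckRing X_φ)` and `V` are birational over `Spec ℂ`
(`birationalOver_deckChart_fiberSch` ∘ brick C3 `nonempty_iso_of_isHypersurfaceCutOutBy_quarticForm`).
[cite: Hartshorne1977, I Example 1.1.3] [cite: Hartshorne1977, II Example 3.2.6] -/
theorem birationalOver_deckChart_of_isHypersurfaceCutOutBy (φ : ParamRing e →+* ℂ) (he : 1 ≤ e)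
    (hG : φ (genericityElem e) ≠ 0) [Nontrivial (DeckRing (fun i => φ (X i) : CIdx e → ℂ))] {V : SchemeOver ℂ}
    (hV : IsHypersurfaceCutOutBy 3 (quarticForm e (cOf fun i => φ (X i)) (ψOf fun i => φ (X i))) V) :
    Scheme.BirationalOver (Spec.map (CommRingCat.ofHom (algebraMap ℂ (DeckRing (fun i => φ (X i) : CIdx e → ℂ))))) V.hom := by
  letI : Algebra (ParamRing e) ℂ := φ.toAlgebra
  haveI : Nontrivial (DeckRing (algebraMap (ParamRing e) ℂ ∘ univCoeffs e)) :=
    ‹Nontrivial (DeckRing (fun i => φ (X i) : CIdx e → ℂ))›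
  have h1 := birationalOver_deckChart_fiberSch e (L := ℂ) he hG
  obtain ⟨i⟩ := nonempty_iso_of_isHypersurfaceCutOutBy_quarticForm (e := e) φ he hG hV
  exact h1.trans (birationalOver_of_iso i)

end ComplexPoints

end Literature.AlgebraicGeometry.HodgeTheory.Q8Family

end
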